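import Summits.HubbardSuperconductivity.HubbardSuperconductivity.Theses.ThermalWedge
import Summits.HubbardSuperconductivity.HubbardSuperconductivity.Theorems.ThermalWedgeTwApproximatingHamiltonian
import Summits.HubbardSuperconductivity.HubbardSuperconductivity.Theorems.ThermalWedgeTwSeededRungSectorGibbs
import Summits.HubbardSuperconductivity.HubbardSuperconductivity.Theorems.ThermalWedgeTwSeededEnsembleEquivalenceEvenSectorMin
import Summits.HubbardSuperconductivity.HubbardSuperconductivity.Theorems.ThermalWedgeTwSeededEnsembleEquivalencePairFieldSinglet
import Summits.HubbardSuperconductivity.HubbardSuperconductivity.Theorems.ThermalWedgeTwSeededEnsembleEquivalenceSeedCommutator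
import Summits.HubbardSuperconductivity.HubbardSuperconductivity.Theorems.ThermalWedgeTwSeededEnsembleEquivalenceSectorWeightBasics
import Summits.HubbardSuperconductivity.HubbardSuperconductivity.Theorems.ThermalWedgeTwSeededEnsembleEquivalenceSectorTraceToolkit
import Summits.HubbardSuperconductivity.HubbardSuperconductivity.Theorems.ThermalWedgeTwSeededEnsembleEquivalenceCommutatorSums
import Summits.HubbardSuperconductivity.HubbardSuperconductivity.Theorems.ThermalWedgeTwSeededEnsembleEquivalenceAhmTransfer
import Summits.HubbardSuperconductivity.HubbardSuperconductivity.Theorems.ThermalWedgeTwSeededEnsembleEquivalenceThermalWalk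
import Summits.HubbardSuperconductivity.HubbardSuperconductivity.Theorems.ThermalWedgeTwSeededEnsembleEquivalenceThermalCloser
import Literature.MathematicalPhysics.QuantumLattice.HubbardCommutatorBound
import Literature.MathematicalPhysics.QuantumLattice.DWaveSourceProofs
import Literature.MathematicalPhysics.QuantumLattice.DWaveSourceFreePressure
import Literature.MathematicalPhysics.QuantumLattice.ApproximatingHamiltonianProofs

/-!
# Crux `TwSeededEnsembleEquivalence` (stmt-HubbardSuperconductivity-1698) — line `exposed-density-duality`,
# SKELETON v17: the THERMAL member of the line (lead gen 2 v11, 2026-08-16; lead c2: ALL SIX bookkeeping stubs A B C D E F LANDED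
# and imported — the crux is closed BY NAME modulo the single physics stub G below)
#
# IN THE TREE (Theorems/, all `--supports` this item, namespace `…ThermalDuality`): the same composition with G as an explicit
# hypothesis, route-file free — `twSeededEnsembleEquivalence_of_secantBracket` and the thermal-window consumer
# `tw_thermalWindowEnsemble_of_secantBracket` (…OfSecantBracket.lean, lead c2, p109581); the LIMIT-FORM physics input and its consumers —
# `stub_thermalBracket_of_differentiableLimit` (…BracketOfDifferentiableLimit.lean), `stub_seededLimit_of_sourcedLimit`
# (…SeededLimitOfSourcedLimit.lean), `twSeededEnsembleEquivalence_of_differentiablePressure`, `tw_thermalWindowEnsemble_of_differentiablePressure`,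
# `twSeededRung_of_differentiablePressure` (…OfDifferentiablePressure.lean; route-prover seat). So the physics of this crux — as filed or
# restated to the thermal window `hEns` — is supplied by EITHER "finite-volume secant bracket of the sourced Bogoliubov functional at an
# L-independent μ₀" (G / its ∃a restriction) OR "the infinite-volume seeded pressure exists and has no kink on the δ-window" (TDL+DIFF+EDGE).

The crux of route `ThermalWedge`,

  ∀ δ ∈ [1/10,2/5] ∃ −4<μ₁≤μ₂<0 ∃ U₀>0 ∀ U∈(0,U₀] ∀ g∈(0,1/10] ∀ β≥1 ∃ μ∈[μ₁,μ₂] ∀ ε>0, eventually in L: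
      e_L(g) + p_L(β,μ,g) − μ n_L ≤ log 4/β + ε,

is closed BY NAME (`TwSeededEnsembleEquivalence_of`) from seven registered stubs, six of which are
finite-dimensional thermal bookkeeping — ALL SIX LANDED under Theorems/ (A gen 2; B C D E F lead c2) — and ONE is the
physics input, stated on the SOURCED SHORT-RANGE torus at POSITIVE temperature only (the one remaining `sorry`):

* `stub_sectorWeightBasics`      — particle-number sector weights `W_L(N; β, μ) = Σ_{|s|=N} (e^{−βK_L(μ)})_{ss}`
                                    of the seeded grand-canonical torus `K_L(μ) = hubbardTorusWith 2 L 1 U μ − (g/L²)P_L`: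
                                    sector decomposition of `Z`, `μ`-tilt, positivity, and the probabilistic normal
                                    form of the defect `β(E_V − μN) + log Z ≤ L² log 4 + log (Z / W_L(N))`
                                    (tree: `re_trace_projMatrix_mul_gibbsWeight_le`, landed `stub_evenSectorMin`);
* `stub_sectorTraceToolkit`      — two abstract trace inequalities on the Fock space: the JENSEN TRACE INEQUALITY
                                    `Tr P e^{−βΣᵢVᵢᴴKVᵢ} ≤ Σᵢ Tr Vᵢᴴe^{−βK}Vᵢ` for a Kraus family `ΣᵢVᵢᴴVᵢ = P`
                                    (`P` a sector projection), and Loewner monotonicity of `X ↦ Tr P e^{−βX}` on `PXP`'s;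
* `stub_commutatorSums`          — `‖Σ_o c_o†[K_L(0), c_o]‖, ‖Σ_o c_o[K_L(0), c_o†]‖ ≤ (18(2+|U|) + gC)·2L²`
                                    (tree one-orbital bounds + landed `stub_seedCommutator`);
* `stub_thermalWalk`             — the THERMAL ONE-PARTICLE WALK `W_L(N) ≤ ((2L²−N+1)/N)·e^{βR/N}·W_L(N−1)` and
                                    `W_L(N) ≤ ((N+1)/(2L²−N))·e^{βR/(2L²−N)}·W_L(N+1)` (from the two previous stubs,
                                    taken as hypotheses): the positive-temperature replacement of the T = 0 one-particle cost;
* `stub_thermalCloser`           — CHERNOFF + WALK: a two-sided secant bracket of the finite-volume seeded PRESSURE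
                                    `p_L(β,·)` at `μ₀` (tolerance `η`, step `τ(η)`, eventually in `L`) forces the crux
                                    instance at `(β, μ₀)` (held by the lead);
* `stub_ahmTransfer`             — the landed approximating-Hamiltonian theorem (item 1703, pointwise in `μ`, used at the
                                    three points `μ₀, μ₀ ± τ`) moves the bracket from the Bogoliubov functional
                                    `B̃_L(β,μ) = sup_h [p̃_L(β,μ,h) − h²/g]` of the SOURCED short-range torus to `p_L`;
* `stub_thermalSourcedSecantBracket` — THE PHYSICS INPUT: for every `β ≥ 1` an `L`-independent `μ₀(δ,U,g,β)` in the
                                    `δ`-window at which `B̃_L(β,·)` has both one-sided secants within `η` of `1 − δ`,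
                                    eventually in `L` (no first-order density jump of the seeded model across `1 − δ`
                                    at inverse temperature `β`). Its restriction to `β ≤ e^{a/U}`, `g ≥ K'U` is the
                                    doubly-narrowed instance the route's engine consumes
                                    (`twSeededRung_structural_narrowSeed`), and lives in the technique class of cruxes
                                    1696/1697 (sourced convergent expansion at `T ≥ e^{−a/U}`, one `μ`-derivative deeper);
                                    `twSeededEnsembleEquivalence_narrowSeed_of` below records that composition too.

Why v11 (the thermal member) after v10 (the T = 0 member, `Lines/exposed_density_duality.lean`, closed modulo
`stub_sourcedSecantBracketT0`): by the disprover's Template C/D the crux is its own T = 0 instance, and the T = 0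
secant bracket is undecidable by every known technique (gens 0–1, advisor, disprover gens 1–4). The thermal
composition proves the SAME crux by name but isolates the physics at each finite `β` separately, so that the
narrowing every seat has recommended (β ≤ e^{a/U}, g ≥ K'U) is a RESTRICTION OF ONE REGISTERED STUB and the six
bookkeeping stubs serve the narrowed statement verbatim.

Notation (all terms are literal tree terms; no definitions are introduced):
`P_L = (pairField dWaveFormFactor L)ᴴ(pairField dWaveFormFactor L)`, `K_L(μ) = hubbardTorusWith 2 L 1 U μ − (g/L²)P_L`,
`Hcan = hubbardTorus 2 L 1 U − (g/L²)P_L`, `W_L(N; β, μ) = Σ_{s : |s| = N} Re (gibbsWeight β (K_L μ))_{ss}`,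
`p_L(β,μ) = log Re Z(β, K_L(μ))/(βL²)`, `p̃_L(β,μ,h) = log Re Z(β, dWaveSourceTorus L U μ h)/(βL²)`, `N_L = 2⌊(1−δ)L²/2⌋₊`.
-/

set_option linter.dupNamespace false

namespace Summit.HubbardSuperconductivity.HubbardSuperconductivity.Theorems.TwSeededEnsembleEquivalence.ThermalDuality

open Matrix Filter Topology Finset Literature.MathematicalPhysics.QuantumLattice
open Summit.HubbardSuperconductivity.HubbardSuperconductivity.Theses.ThermalWedge
open Summit.HubbardSuperconductivity.HubbardSuperconductivity.Theorems.TwSeededEnsembleEquivalence.ExposedDensity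
open scoped ComplexOrder Matrix.Norms.L2Operator

noncomputable section

/-! ## Stubs -/

-- `stub_sectorWeightBasics` (STUB A — sector-weight basics) LANDED (module
-- `…Theorems.ThermalWedgeTwSeededEnsembleEquivalenceSectorWeightBasics`, same namespace, imported above).

-- `stub_sectorTraceToolkit` (STUB B — sector trace toolkit: Jensen trace inequality + restricted Loewner monotonicity)
-- LANDED at p101442 (module `…Theorems.ThermalWedgeTwSeededEnsembleEquivalenceSectorTraceToolkit`, imported above).

-- `stub_commutatorSums` (STUB C — commutator sums) LANDED at p101039 (module
-- `…Theorems.ThermalWedgeTwSeededEnsembleEquivalenceCommutatorSums`, imported above).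

-- `stub_thermalWalk` (STUB D — the thermal one-particle walk) LANDED at p102786 (module
-- `…Theorems.ThermalWedgeTwSeededEnsembleEquivalenceThermalWalk`, imported above; registered text re-set comment-free by the worker).

-- `stub_thermalCloser` (STUB E — the thermal closer, Chernoff + walk) LANDED at p102416 (part 1, registered sub-goal
-- `chernoffWalk_core`, module `…ThermalCloserCore`) + p104255 (part 2, module `…Theorems.ThermalWedgeTwSeededEnsembleEquivalenceThermalCloser`,
-- imported above).

/-- STUB G — THE PHYSICS INPUT (the crux's content, in thermal dress, on the SOURCED SHORT-RANGE MODEL ONLY):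
**THERMAL SECANT BRACKET OF THE FINITE-VOLUME BOGOLIUBOV FUNCTIONAL** `B̃_L(β,μ) := ⨆_{h ∈ ℝ} [p̃_L(β,μ,h) − h²/g]`,
`p̃_L(β,μ,h) = log Re Z(β, dWaveSourceTorus L U μ h)/(βL²)` (a supremum of convex functions of `μ`; bounded above by
the seeded pressure, AHM easy half). For every `δ` in the window there are a `δ`-uniform window `[μ₁,μ₂] ⊂ (−4,0)` and
`U₀ > 0` such that for all `0 < U ≤ U₀`, `0 < g ≤ 1/10` and every `β ≥ 1` an `L`-INDEPENDENT `μ₀ = μ₀(δ,U,g,β) ∈ [μ₁,μ₂]`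
has, for every `η > 0`, a step `τ > 0` with both one-sided secants of `B̃_L(β,·)` at `μ₀` within `η` of the density
`1 − δ`, eventually in `L`. By Danskin this says: all asymptotically optimal sources `h*` at `(β, μ₀)` carry sourced
density `1 − δ` — no first-order density jump of the seeded model across `1 − δ` at inverse temperature `β`.
WHAT IS IN CLASS AND WHAT IS NOT: by the disprover's Template D the instances are downward closed in `β`, and as
`β → ∞` the statement carries the crux's T = 0 content (undecidable today: line reports gens 0–1); its restriction to
`1 ≤ β ≤ e^{a/U}`, `g ≥ K'·U` — the instance the route's engine `twSeededRung_structural_narrowSeed` consumes, see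
`twSeededEnsembleEquivalence_narrowSeed_of` — is a statement about the sourced convergent expansion at
`T ≥ e^{−a/U}` (cruxes 1696/1697: `μ`-differentiability of the limiting sourced pressure at the AHM optimum and
uniqueness of the optimal source modulus), i.e. inside the route's declared technique class. -/
theorem stub_thermalSourcedSecantBracket :
    ∀ δ ∈ Set.Icc (1/10 : ℝ) (2/5 : ℝ), ∃ μ₁ μ₂ : ℝ, -4 < μ₁ ∧ μ₁ ≤ μ₂ ∧ μ₂ < 0 ∧
      ∃ U₀ : ℝ, 0 < U₀ ∧ ∀ U ∈ Set.Ioc (0 : ℝ) U₀, ∀ g ∈ Set.Ioc (0 : ℝ) (1 / 10), ∀ β : ℝ, 1 ≤ β →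
        ∃ μ₀ ∈ Set.Icc μ₁ μ₂, ∀ η : ℝ, 0 < η → ∃ τ : ℝ, 0 < τ ∧ ∃ L₀ : ℕ, ∀ (L : ℕ) [NeZero L], L₀ ≤ L →
          ((⨆ h : ℝ, ((Real.log (Matrix.partitionFn β (dWaveSourceTorus L U (μ₀ + τ) h)).re / (β * (L : ℝ) ^ 2)) -
              h ^ 2 / g)) -
            (⨆ h : ℝ, ((Real.log (Matrix.partitionFn β (dWaveSourceTorus L U μ₀ h)).re / (β * (L : ℝ) ^ 2)) -
              h ^ 2 / g))) / τ ≤ (1 - δ) + η ∧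
          (1 - δ) - η ≤
          ((⨆ h : ℝ, ((Real.log (Matrix.partitionFn β (dWaveSourceTorus L U μ₀ h)).re / (β * (L : ℝ) ^ 2)) -
              h ^ 2 / g)) -
            (⨆ h : ℝ, ((Real.log (Matrix.partitionFn β (dWaveSourceTorus L U (μ₀ - τ) h)).re / (β * (L : ℝ) ^ 2)) -
              h ^ 2 / g))) / τ := by
  sorry

/-! ## Proved composition -/

/-- The walk hypothesis of the closer, at the constant `C = 2(18(2+|U|) + gC₀)`, from the walk stub, the trace
toolkit and the commutator sums. -/
theorem thermalWalk_of_stubs (U g β : ℝ) (hg : 0 ≤ g) (hβ : 0 ≤ β) :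
    ∃ C : ℝ, 0 ≤ C ∧ ∀ (L : ℕ) [NeZero L] (N : ℕ),
        (1 ≤ N → N ≤ 2 * L ^ 2 →
          ∑ s ∈ (Finset.univ.filter fun s : Finset (Orb (FermionTorus 2 L)) => s.card = N),
              (Matrix.gibbsWeight β (hubbardTorusWith 2 L 1 U 0 - ((g / (L : ℝ) ^ 2 : ℝ) : ℂ) •
                ((pairField dWaveFormFactor L)ᴴ * pairField dWaveFormFactor L)) s s).re ≤
            ((2 * (L : ℝ) ^ 2 - N + 1) / N) * Real.exp (β * (C * (L : ℝ) ^ 2) / N) *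
              ∑ s ∈ (Finset.univ.filter fun s : Finset (Orb (FermionTorus 2 L)) => s.card = N - 1),
                (Matrix.gibbsWeight β (hubbardTorusWith 2 L 1 U 0 - ((g / (L : ℝ) ^ 2 : ℝ) : ℂ) •
                  ((pairField dWaveFormFactor L)ᴴ * pairField dWaveFormFactor L)) s s).re) ∧
        (N + 1 ≤ 2 * L ^ 2 →
          ∑ s ∈ (Finset.univ.filter fun s : Finset (Orb (FermionTorus 2 L)) => s.card = N),
              (Matrix.gibbsWeight β (hubbardTorusWith 2 L 1 U 0 - ((g / (L : ℝ) ^ 2 : ℝ) : ℂ) •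
                ((pairField dWaveFormFactor L)ᴴ * pairField dWaveFormFactor L)) s s).re ≤
            ((N + 1) / (2 * (L : ℝ) ^ 2 - N)) * Real.exp (β * (C * (L : ℝ) ^ 2) / (2 * (L : ℝ) ^ 2 - N)) *
              ∑ s ∈ (Finset.univ.filter fun s : Finset (Orb (FermionTorus 2 L)) => s.card = N + 1),
                (Matrix.gibbsWeight β (hubbardTorusWith 2 L 1 U 0 - ((g / (L : ℝ) ^ 2 : ℝ) : ℂ) •
                  ((pairField dWaveFormFactor L)ᴴ * pairField dWaveFormFactor L)) s s).re) := by
  obtain ⟨C₀, hC₀, hcomm⟩ := stub_commutatorSums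
  refine ⟨2 * (18 * (2 + |U|) + g * C₀), by positivity, fun L _ N => ?_⟩
  obtain ⟨hJ, hM⟩ := stub_sectorTraceToolkit L
  obtain ⟨h1, h2⟩ := hcomm L U g hg
  have hR : (18 * (2 + |U|) + g * C₀) * (2 * (L : ℝ) ^ 2) = 2 * (18 * (2 + |U|) + g * C₀) * (L : ℝ) ^ 2 := by
    ring
  rw [hR] at h1 h2
  exact stub_thermalWalk L U g β (2 * (18 * (2 + |U|) + g * C₀) * (L : ℝ) ^ 2) hβ hJ hM h1 h2 N

/-- **The line (thermal member).** `TwSeededEnsembleEquivalence` from the stubs: the physics stub (thermal secant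
bracket of the Bogoliubov functional of the sourced torus) ⟹ (AHM transfer, item 1703 landed) secant bracket of the
seeded pressure at `μ₀(δ,U,g,β)` ⟹ (Chernoff + thermal one-particle walk + sector entropy bound) the crux instance at
`(β, μ₀)`, for every `β ≥ 1`. -/
theorem TwSeededEnsembleEquivalence_of : TwSeededEnsembleEquivalence := by
  intro δ hδ
  obtain ⟨μ₁, μ₂, hμ₁, hμ₁₂, hμ₂, U₀, hU₀, hmain⟩ := stub_thermalSourcedSecantBracket δ hδ
  refine ⟨μ₁, μ₂, hμ₁, hμ₁₂, hμ₂, U₀, hU₀, fun U hU g hg β hβ => ?_⟩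
  obtain ⟨μ₀, hμ₀, hbrB⟩ := hmain U hU g hg β hβ
  refine ⟨μ₀, hμ₀, ?_⟩
  have hβ0 : 0 < β := lt_of_lt_of_le one_pos hβ
  have hbr := stub_ahmTransfer δ U g β μ₀ hg.1 hβ0 twApproximatingHamiltonian_proof hbrB
  obtain ⟨C, hC, hwalk⟩ := thermalWalk_of_stubs U g β hg.1.le hβ0.le
  exact stub_thermalCloser δ U g β μ₀ C hδ hβ hC (fun L _ => stub_sectorWeightBasics L U g β hβ0) hwalk hbr

/-- **The line, doubly-narrowed form (what the route's engine consumes).** If the physics input is only available on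
`1 ≤ β ≤ e^{a/U}` and `g ≥ K'·U` (hypothesis `hGn`, the IN-CLASS restriction of `stub_thermalSourcedSecantBracket`),
the same composition yields the `(β, g)`-narrowed ensemble input `hEns` of `twSeededRung_structural_narrowSeed`
(Theorems/ThermalWedgeTwSeededRungNarrowSeed.lean) verbatim. Not a registered stub: recorded for the planner. -/
theorem twSeededEnsembleEquivalence_narrowSeed_of
    (hGn : ∀ δ ∈ Set.Icc (1/10 : ℝ) (2/5 : ℝ), ∃ μ₁ μ₂ : ℝ, -4 < μ₁ ∧ μ₁ ≤ μ₂ ∧ μ₂ < 0 ∧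
      ∀ a : ℝ, 0 < a → ∃ K' U₀ : ℝ, 0 < K' ∧ 0 < U₀ ∧ ∀ U ∈ Set.Ioc (0 : ℝ) U₀,
        ∀ g ∈ Set.Icc (K' * U) (1 / 10), ∀ β : ℝ, 1 ≤ β → β ≤ Real.exp (a / U) →
          ∃ μ₀ ∈ Set.Icc μ₁ μ₂, ∀ η : ℝ, 0 < η → ∃ τ : ℝ, 0 < τ ∧ ∃ L₀ : ℕ, ∀ (L : ℕ) [NeZero L], L₀ ≤ L →
            ((⨆ h : ℝ, ((Real.log (Matrix.partitionFn β (dWaveSourceTorus L U (μ₀ + τ) h)).re / (β * (L : ℝ) ^ 2)) -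
                h ^ 2 / g)) -
              (⨆ h : ℝ, ((Real.log (Matrix.partitionFn β (dWaveSourceTorus L U μ₀ h)).re / (β * (L : ℝ) ^ 2)) -
                h ^ 2 / g))) / τ ≤ (1 - δ) + η ∧
            (1 - δ) - η ≤
            ((⨆ h : ℝ, ((Real.log (Matrix.partitionFn β (dWaveSourceTorus L U μ₀ h)).re / (β * (L : ℝ) ^ 2)) -
                h ^ 2 / g)) -
              (⨆ h : ℝ, ((Real.log (Matrix.partitionFn β (dWaveSourceTorus L U (μ₀ - τ) h)).re / (β * (L : ℝ) ^ 2)) -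
                h ^ 2 / g))) / τ) :
    ∀ δ ∈ Set.Icc (1/10 : ℝ) (2/5 : ℝ), ∃ μ₁ μ₂ : ℝ, -4 < μ₁ ∧ μ₁ ≤ μ₂ ∧ μ₂ < 0 ∧
      ∀ a : ℝ, 0 < a → ∃ K' U₀ : ℝ, 0 < K' ∧ 0 < U₀ ∧ ∀ U ∈ Set.Ioc (0 : ℝ) U₀,
        ∀ g ∈ Set.Icc (K' * U) (1 / 10), ∀ β : ℝ, 1 ≤ β → β ≤ Real.exp (a / U) →
          ∃ μ ∈ Set.Icc μ₁ μ₂, ∀ ε : ℝ, 0 < ε → ∃ L₀ : ℕ, ∀ (L : ℕ) [NeZero L], L₀ ≤ L →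
            ((hubbardTorus 2 L 1 U - ((g / (L : ℝ) ^ 2 : ℝ) : ℂ) •
              ((pairField dWaveFormFactor L)ᴴ * pairField dWaveFormFactor L)).minEnergyOn
                (szSector (Λ := FermionTorus 2 L) (2 * ⌊(1 - δ) * (L : ℝ) ^ 2 / 2⌋₊) 0) /
                  (L : ℝ) ^ 2) +
              (Real.log (Matrix.partitionFn β (hubbardTorusWith 2 L 1 U μ -
                ((g / (L : ℝ) ^ 2 : ℝ) : ℂ) •
                  ((pairField dWaveFormFactor L)ᴴ * pairField dWaveFormFactor L))).re /
                    (β * (L : ℝ) ^ 2)) -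
              μ * ((2 * ⌊(1 - δ) * (L : ℝ) ^ 2 / 2⌋₊) : ℝ) / (L : ℝ) ^ 2 ≤ Real.log 4 / β + ε := by
  intro δ hδ
  obtain ⟨μ₁, μ₂, hμ₁, hμ₁₂, hμ₂, hmain⟩ := hGn δ hδ
  refine ⟨μ₁, μ₂, hμ₁, hμ₁₂, hμ₂, fun a ha => ?_⟩
  obtain ⟨K', U₀, hK', hU₀, hmain'⟩ := hmain a ha
  refine ⟨K', U₀, hK', hU₀, fun U hU g hg β hβ hβa => ?_⟩
  obtain ⟨μ₀, hμ₀, hbrB⟩ := hmain' U hU g hg β hβ hβa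
  refine ⟨μ₀, hμ₀, ?_⟩
  have hβ0 : 0 < β := lt_of_lt_of_le one_pos hβ
  have hg0 : 0 < g := lt_of_lt_of_le (mul_pos hK' hU.1) hg.1
  have hbr := stub_ahmTransfer δ U g β μ₀ hg0 hβ0 twApproximatingHamiltonian_proof hbrB
  obtain ⟨C, hC, hwalk⟩ := thermalWalk_of_stubs U g β hg0.le hβ0.le
  exact stub_thermalCloser δ U g β μ₀ C hδ hβ hC (fun L _ => stub_sectorWeightBasics L U g β hβ0) hwalk hbr


/-- **The line, thermal-window form (`∃ a`; exactly the hypothesis `hEns` of the route's landed engine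
`twSeededRung_structural_thermalWindow`, Theorems/ThermalWedgeTwSeededRungThermalWindow.lean).** If the physics input is
available on ONE thermal window `1 ≤ β ≤ e^{a/U}` with seed floor `g ≥ K'·U` (hypothesis `hGw`, the `∃ a` restriction of
`stub_thermalSourcedSecantBracket` — the form that stays above the convergent expansion's ceiling `a ≤ a₀`), the same
composition yields `hEns` verbatim. Not a registered stub: recorded for the planner (restated-crux target). -/
theorem twSeededEnsembleEquivalence_thermalWindow_of
    (hGw : ∀ δ ∈ Set.Icc (1/10 : ℝ) (2/5 : ℝ), ∃ μ₁ μ₂ : ℝ, -4 < μ₁ ∧ μ₁ ≤ μ₂ ∧ μ₂ < 0 ∧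
      ∃ a K' U₀ : ℝ, 0 < a ∧ 0 < K' ∧ 0 < U₀ ∧ ∀ U ∈ Set.Ioc (0 : ℝ) U₀,
        ∀ g ∈ Set.Icc (K' * U) (1 / 10), ∀ β : ℝ, 1 ≤ β → β ≤ Real.exp (a / U) →
          ∃ μ₀ ∈ Set.Icc μ₁ μ₂, ∀ η : ℝ, 0 < η → ∃ τ : ℝ, 0 < τ ∧ ∃ L₀ : ℕ, ∀ (L : ℕ) [NeZero L], L₀ ≤ L →
            ((⨆ h : ℝ, ((Real.log (Matrix.partitionFn β (dWaveSourceTorus L U (μ₀ + τ) h)).re / (β * (L : ℝ) ^ 2)) -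
                h ^ 2 / g)) -
              (⨆ h : ℝ, ((Real.log (Matrix.partitionFn β (dWaveSourceTorus L U μ₀ h)).re / (β * (L : ℝ) ^ 2)) -
                h ^ 2 / g))) / τ ≤ (1 - δ) + η ∧
            (1 - δ) - η ≤
            ((⨆ h : ℝ, ((Real.log (Matrix.partitionFn β (dWaveSourceTorus L U μ₀ h)).re / (β * (L : ℝ) ^ 2)) -
                h ^ 2 / g)) -
              (⨆ h : ℝ, ((Real.log (Matrix.partitionFn β (dWaveSourceTorus L U (μ₀ - τ) h)).re / (β * (L : ℝ) ^ 2)) -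
                h ^ 2 / g))) / τ) :
    ∀ δ ∈ Set.Icc (1/10 : ℝ) (2/5 : ℝ), ∃ μ₁ μ₂ : ℝ, -4 < μ₁ ∧ μ₁ ≤ μ₂ ∧ μ₂ < 0 ∧
      ∃ a K' U₀ : ℝ, 0 < a ∧ 0 < K' ∧ 0 < U₀ ∧ ∀ U ∈ Set.Ioc (0 : ℝ) U₀,
        ∀ g ∈ Set.Icc (K' * U) (1 / 10), ∀ β : ℝ, 1 ≤ β → β ≤ Real.exp (a / U) →
          ∃ μ ∈ Set.Icc μ₁ μ₂, ∀ ε : ℝ, 0 < ε → ∃ L₀ : ℕ, ∀ (L : ℕ) [NeZero L], L₀ ≤ L →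
            ((hubbardTorus 2 L 1 U - ((g / (L : ℝ) ^ 2 : ℝ) : ℂ) •
              ((pairField dWaveFormFactor L)ᴴ * pairField dWaveFormFactor L)).minEnergyOn
                (szSector (Λ := FermionTorus 2 L) (2 * ⌊(1 - δ) * (L : ℝ) ^ 2 / 2⌋₊) 0) /
                  (L : ℝ) ^ 2) +
              (Real.log (Matrix.partitionFn β (hubbardTorusWith 2 L 1 U μ -
                ((g / (L : ℝ) ^ 2 : ℝ) : ℂ) •
                  ((pairField dWaveFormFactor L)ᴴ * pairField dWaveFormFactor L))).re /
                    (β * (L : ℝ) ^ 2)) -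
              μ * ((2 * ⌊(1 - δ) * (L : ℝ) ^ 2 / 2⌋₊) : ℝ) / (L : ℝ) ^ 2 ≤ Real.log 4 / β + ε := by
  intro δ hδ
  obtain ⟨μ₁, μ₂, hμ₁, hμ₁₂, hμ₂, a, K', U₀, ha, hK', hU₀, hmain⟩ := hGw δ hδ
  refine ⟨μ₁, μ₂, hμ₁, hμ₁₂, hμ₂, a, K', U₀, ha, hK', hU₀, fun U hU g hg β hβ hβa => ?_⟩
  obtain ⟨μ₀, hμ₀, hbrB⟩ := hmain U hU g hg β hβ hβa
  refine ⟨μ₀, hμ₀, ?_⟩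
  have hβ0 : 0 < β := lt_of_lt_of_le one_pos hβ
  have hg0 : 0 < g := lt_of_lt_of_le (mul_pos hK' hU.1) hg.1
  have hbr := stub_ahmTransfer δ U g β μ₀ hg0 hβ0 twApproximatingHamiltonian_proof hbrB
  obtain ⟨C, hC, hwalk⟩ := thermalWalk_of_stubs U g β hg0.le hβ0.le
  exact stub_thermalCloser δ U g β μ₀ C hδ hβ hC (fun L _ => stub_sectorWeightBasics L U g β hβ0) hwalk hbr

end

end Summit.HubbardSuperconductivity.HubbardSuperconductivity.Theorems.TwSeededEnsembleEquivalence.ThermalDuality
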